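import Summits.BirchSwinnertonDyer.Rank1Residual.Additive.QuadraticTwistTowerNoPTorsion
import Summits.BirchSwinnertonDyer.Rank1Residual.Additive.StrictSignedControlZeroExactRat
import HarnessLib

/-!
# The EXACT strict-minus bottom-layer identity for the `p`-STRICT Selmer group of a quadratic
# TWIST of a good supersingular curve, with NO auxiliary hypothesis:
# `ord_p #Sel_str(W/ℚ)[p^∞] + ord_p #(Sel^{loc,∞}(W/ℚ) ⧸ Sel^{−,str}(W/ℚ_0)) = ord_p f(0)`
# (cell `b2b-bsdres`, CLASS-CLOSURE lane, class O10 — x1b GEN 36, class lead; file 57 of the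
# series: gen 34's file 43 and gen 35's file 49 for the TWIST `W = V ⊗ η_c`, their hypothesis
# `W(ℚ_∞)[p^∞] = 0` / `W(ℚ_∞·ℚ_p)[p^∞] = 0` discharged by file 55)

HONEST FRAMING (cell `b2b-bsdres`, run/shared/lean/b2b/bsd-rank1-residual/, verbatim in every
file): the goal of the cell is to DELETE the COMBINATION-SHAPED residual classes of the
Birch–Swinnerton-Dyer formula for ALL analytic-rank `≤ 1` elliptic curves over `ℚ` — "full BSD
formula for every rank `≤ 1` curve in class `C`" assembled STRICTLY from published theorems — so
that the rank-`≤ 1` remainder becomes exactly the CONSTRUCTION-SHAPED classes, which are TYPED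
(missing-input `Prop`s), NOT attempted. This is not "finishing BSD". CLASS-CLOSURE lane: prove
what is provable now; shrink each hard class to its core with data; no claim beyond stated classes;
research routes on CONSTRUCTION-SHAPED X12 / O10; census / instrument output = EVIDENCE / conjecture
items, NEVER a Literature fact; `RESIDUAL-MAP.md` marks change only by signed lines. THIS FILE:
TOOL THEOREMS ONLY — no definition, no named Literature fact, no Summits-side fact `def … : Prop`,
no `sorry`, axioms standard; nothing is booked; no label / mark / count / sub-cell moves; (C1_η),
(C2_η-GZ), (C3_η) stay typed as filed (cc-typer-6's pen); O10 stays OPEN / CONSTRUCTION-SHAPED;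
nothing about `BSD(W, p)` of any pair is claimed.

## What (the Selmer side of the typed (C3_η) `QuadraticBranchOddStrictExactControlOfPlusMCAt`)

The typed (C3_η) reads `ord_p #Sel_str(W/ℚ)[p^∞] + ν + ord_p(Tam(W)/#W(ℚ)_tors²) = v_p(coeff₁ L⁻_η)`
for the `p*`-twist `W` of a good `a_p = 0` curve `V`. Its Selmer side in the kernel is the exact
bottom-layer control of Kobayashi's strict-minus structure for `W` along the cyclotomic tower; after
this file it carries NO hypothesis besides the strict-minus dual datum `D` and its `Λ`-module
properties ((C1_η)-side data: Kobayashi Thm. 2.2 / 7.4 read on `D`, Kitajima–Otsuki):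

* `finite_and_padicValNat_card_strictSelmerPInfty_add_eq_of_quadraticTwist` (+ `_signedPrime`):
  **`ord_p #Sel_str(W/ℚ)[p^∞] + ord_p #(A₀ ⧸ Sel^{−,str}(W/ℚ_0)) = ord_p f(0)`**,
  `A₀ = h₀⁻¹(Sel^{−,str}(W/ℚ_∞))` (gen 34's file 43 with (hB) from file 55);
* `finite_and_padicValNat_card_strictSelmerPInfty_localPreimage_add_eq_of_quadraticTwist`
  (+ `_signedPrime`): the same with `A₀` replaced by the group `Sel^{loc,∞}(W/ℚ)` of classes over
  `ℚ` satisfying the LEVEL-`∞` local conditions (file 55's B1 ⊕ B2 for the twist at `ε = −1`,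
  read on `strictSelmerPInfty W p` through p17's FILE 3
  `natCard_strictSignedSelmerLayer_neg_one_zero_eq_strictSelmerPInfty`).

So, for the TWIST, the missing input of (C3_η)'s Selmer side is EXACTLY the count of the defect
`Sel^{loc,∞}(W/ℚ) ⧸ Sel^{−,str}(W/ℚ_0)` (`= ν + ord_p Tam(W)`: the global count (C), bricks B3, B5–B7;
algebra of B7 in file 56 `DefectCountAlgebra`), and (C1_η) read on `D` (`ord_p f(0) = v_p(coeff₁ L⁻_η)`).

References: [Kobayashi2003] §2 p. 4, Prop. 8.7 (p. 16), Lemma 9.1 (p. 25), Thm. 9.3 (p. 26);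
[GreenbergLNM1716] §3 Lemma 3.1–3.3, §4 Lemma 4.2 (p. 102); [Skinner2020] §2.2.
-/

noncomputable section

open scoped Classical

open WeierstrassCurve Literature.NumberTheory.EllipticCurves Literature.NumberTheory.GaloisRepresentations
  Literature.NumberTheory.EllipticCurves.IwasawaAlgebra Literature.NumberTheory.EllipticCurves.IwasawaDual
  Literature.NumberTheory.EllipticCurves.Kobayashi2003 ZpExtension

namespace Summit.BirchSwinnertonDyer.Rank1Residual.Additive

namespace StrictSignedControlZero

variable (W : WeierstrassCurve ℚ) {p : ℕ} [hp : Fact p.Prime] {κ : ZpExtension ℚ p}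
  {γ : Field.absoluteGaloisGroup ℚ}

/-! ## §1 In the currency `A₀ = h₀⁻¹(Sel^{−,str}(W/ℚ_∞))` (gen 34's file 43) -/

/-- **The strict-minus bottom-layer IDENTITY for a quadratic TWIST of a good supersingular curve,
model form, hypothesis-free.** `W/ℚ` elliptic with `C • W^{(c)} = V` (`c ∈ ℚ` a non-square),
`M/ℤ_p` a good supersingular model of `V` over `ℚ̄_p`, `p ≥ 3`; a `ℤ_p`-extension `κ` of `ℚ` with
topological generator `γ`; a strict-minus dual datum `D` of `Sel^{−,str}(W/ℚ_∞)` (model `ℚ_[p]`)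
with `X` f.g. torsion, `char(X) = (f)`, `f(0) ≠ 0`, no non-trivial finite `Λ`-submodule. Then
`Sel_str(W/ℚ)[p^∞]` and `A₀ ⧸ Sel^{−,str}(W/ℚ_0)` are finite and
**`ord_p #Sel_str(W/ℚ)[p^∞] + ord_p #(A₀ ⧸ Sel^{−,str}(W/ℚ_0)) = ord_p f(0)`** — file 43 with its
hypothesis `W(ℚ_∞)[p^∞] = 0` DISCHARGED (file 55
`fixedPoints_kerSubgroup_geomPrimaryTorsion_eq_bot_of_quadraticTwist`).
[cite: Kobayashi2003, Prop. 8.7 (p. 16), Lemma 9.1 (p. 25), §2 p. 4]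
[cite: GreenbergLNM1716, §3 Lemma 3.2, §4 Lemma 4.2 (p. 102)] -/
theorem finite_and_padicValNat_card_strictSelmerPInfty_add_eq_of_quadraticTwist (hp2 : p ≠ 2)
    {c : ℚ} (hc : ∀ q : ℚ, q ^ 2 ≠ c) (C : VariableChange ℚ)
    {V : WeierstrassCurve ℚ} [V.IsElliptic] (hCV : C • W.quadraticTwist c = V)
    (M : WeierstrassCurve ℤ_[p]) (hΔ : IsUnit M.Δ)
    (hA : M.hasseCoeff p ∈ IsLocalRing.maximalIdeal ℤ_[p])
    (hVM : M.baseChange (AlgebraicClosure ℚ_[p]) = V.baseChange (AlgebraicClosure ℚ_[p]))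
    (hγ : κ.IsTopGenerator γ) (D : StrictSignedSelmerDualData W κ ℚ_[p] γ (-1))
    [Module.Finite (IwasawaAlgebra p) D.X] (hX : Module.IsTorsion (IwasawaAlgebra p) D.X)
    (hnf : ∀ N : Submodule (IwasawaAlgebra p) D.X, Finite N → N = ⊥)
    {f : IwasawaAlgebra p} (hf : D.charIdeal = Ideal.span {f})
    (h0 : PowerSeries.constantCoeff f ≠ 0) :
    Finite ↥(strictSelmerPInfty W p) ∧
      Finite (↥((strictSignedSelmerInfty W κ ℚ_[p] (-1)).comap (W.layerToInfty κ 0)) ⧸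
        (strictSignedSelmerLayer W κ ℚ_[p] (-1) 0).addSubgroupOf
          ((strictSignedSelmerInfty W κ ℚ_[p] (-1)).comap (W.layerToInfty κ 0))) ∧
      (padicValNat p (Nat.card ↥(strictSelmerPInfty W p)) : ℤ) +
          padicValNat p (Nat.card (↥((strictSignedSelmerInfty W κ ℚ_[p] (-1)).comap (W.layerToInfty κ 0)) ⧸
            (strictSignedSelmerLayer W κ ℚ_[p] (-1) 0).addSubgroupOf
              ((strictSignedSelmerInfty W κ ℚ_[p] (-1)).comap (W.layerToInfty κ 0)))) =
        ((PowerSeries.constantCoeff f : ℤ_[p]) : ℚ_[p]).valuation :=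
  finite_and_padicValNat_card_strictSelmerPInfty_add_eq W hγ D hX
    (fixedPoints_kerSubgroup_geomPrimaryTorsion_eq_bot_of_quadraticTwist κ hp2 W hc C hCV M hΔ hA hVM)
    hnf hf h0

/-- **The same for the `p*`-twist of a globally minimal good `a_p = 0` curve** (the consumers'
binders `C • W.quadraticTwist ((−1)^{p/2} p) = V`, `V.IsGloballyMinimal`,
`V.HasGoodReductionAtPrime p`, `V.frobeniusTrace p = 0`, `p ≥ 3`).
[cite: Kobayashi2003, Prop. 8.7 (p. 16), Lemma 9.1 (p. 25), §2 p. 4]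
[cite: GreenbergLNM1716, §3 Lemma 3.2, §4 Lemma 4.2 (p. 102)] -/
theorem finite_and_padicValNat_card_strictSelmerPInfty_add_eq_of_quadraticTwist_signedPrime
    (hp2 : p ≠ 2) (C : VariableChange ℚ) (V : WeierstrassCurve ℚ) [V.IsElliptic]
    [V.IsGloballyMinimal] (hCV : C • W.quadraticTwist ((-1) ^ (p / 2) * p) = V)
    (hgood : V.HasGoodReductionAtPrime p) (hap : V.frobeniusTrace p = 0)
    (hγ : κ.IsTopGenerator γ) (D : StrictSignedSelmerDualData W κ ℚ_[p] γ (-1))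
    [Module.Finite (IwasawaAlgebra p) D.X] (hX : Module.IsTorsion (IwasawaAlgebra p) D.X)
    (hnf : ∀ N : Submodule (IwasawaAlgebra p) D.X, Finite N → N = ⊥)
    {f : IwasawaAlgebra p} (hf : D.charIdeal = Ideal.span {f})
    (h0 : PowerSeries.constantCoeff f ≠ 0) :
    Finite ↥(strictSelmerPInfty W p) ∧
      Finite (↥((strictSignedSelmerInfty W κ ℚ_[p] (-1)).comap (W.layerToInfty κ 0)) ⧸
        (strictSignedSelmerLayer W κ ℚ_[p] (-1) 0).addSubgroupOf
          ((strictSignedSelmerInfty W κ ℚ_[p] (-1)).comap (W.layerToInfty κ 0))) ∧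
      (padicValNat p (Nat.card ↥(strictSelmerPInfty W p)) : ℤ) +
          padicValNat p (Nat.card (↥((strictSignedSelmerInfty W κ ℚ_[p] (-1)).comap (W.layerToInfty κ 0)) ⧸
            (strictSignedSelmerLayer W κ ℚ_[p] (-1) 0).addSubgroupOf
              ((strictSignedSelmerInfty W κ ℚ_[p] (-1)).comap (W.layerToInfty κ 0)))) =
        ((PowerSeries.constantCoeff f : ℤ_[p]) : ℚ_[p]).valuation := by
  obtain ⟨M, hΔ, hA, hVM⟩ := exists_goodSupersingularPadicModel hp2 V hgood hap
  exact finite_and_padicValNat_card_strictSelmerPInfty_add_eq_of_quadraticTwist W hp2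
    (sq_ne_neg_one_pow_mul_prime hp.out (p / 2)) C hCV M hΔ hA hVM hγ D hX hnf hf h0

/-! ## §2 In the currency `A₀ = Sel^{loc,∞}(W/ℚ)` (level-`∞` local conditions; file 55 / 49) -/

variable [W.IsElliptic]

/-- **The strict-minus bottom-layer identity for the twist with the defect EXPRESSED BY LOCAL
CONDITIONS, hypothesis-free.** Same data as §1; the second group is
`Sel^{loc,∞}(W/ℚ) ⧸ Sel^{−,str}(W/ℚ_0)`, `Sel^{loc,∞}(W/ℚ)` = the classes over `ℚ` whose restriction
to `ℚ_∞` lies in `Sel_{p^∞}(W/ℚ_∞)` and in the strict-minus Kummer condition cut out by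
`⋃ₙ W^{−,str}(ℚ_n·ℚ_p)` (file 55's B1 ⊕ B2 for the twist at `ε = −1`, first summand read on
`strictSelmerPInfty W p`): **`ord_p #Sel_str(W/ℚ)[p^∞] + ord_p #(Sel^{loc,∞}(W/ℚ) ⧸ Sel^{−,str}(W/ℚ_0))
= ord_p f(0)`**. The remaining input of (C3_η)'s Selmer side for the twist is the COUNT of this
defect (`= ν + ord_p Tam(W)`, bricks B3, B5–B7). [cite: Kobayashi2003, Prop. 8.7 (p. 16), Lemma 9.1 (p. 25), Thm. 9.3 (p. 26)]
[cite: GreenbergLNM1716, §3 pp. 85–90 and §4 Lemma 4.2 (p. 102)] -/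
theorem finite_and_padicValNat_card_strictSelmerPInfty_localPreimage_add_eq_of_quadraticTwist
    (hp2 : p ≠ 2) {c : ℚ} (hc : ∀ q : ℚ, q ^ 2 ≠ c) (C : VariableChange ℚ)
    {V : WeierstrassCurve ℚ} [V.IsElliptic] (hCV : C • W.quadraticTwist c = V)
    (M : WeierstrassCurve ℤ_[p]) (hΔ : IsUnit M.Δ)
    (hA : M.hasseCoeff p ∈ IsLocalRing.maximalIdeal ℤ_[p])
    (hVM : M.baseChange (AlgebraicClosure ℚ_[p]) = V.baseChange (AlgebraicClosure ℚ_[p]))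
    (hγ : κ.IsTopGenerator γ) (D : StrictSignedSelmerDualData W κ ℚ_[p] γ (-1))
    [Module.Finite (IwasawaAlgebra p) D.X] (hX : Module.IsTorsion (IwasawaAlgebra p) D.X)
    (hnf : ∀ N : Submodule (IwasawaAlgebra p) D.X, Finite N → N = ⊥)
    {f : IwasawaAlgebra p} (hf : D.charIdeal = Ideal.span {f})
    (h0 : PowerSeries.constantCoeff f ≠ 0) :
    Finite ↥(strictSelmerPInfty W p) ∧
      Finite (↥((W.selmerInfty κ ⊓
          ⨅ σ : Field.absoluteGaloisGroup ℚ,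
            (localKummerOverOfEmb W p κ.kerSubgroup (closureEmb (K := ℚ) ℚ_[p])
                (⨆ m, strictSignedLocalPoints κ ℚ_[p] W (-1) m)).comap
              (W.conjH1 p κ.kerSubgroup σ)).comap
          (W.layerToInfty κ 0)) ⧸
        (strictSignedSelmerLayer W κ ℚ_[p] (-1) 0).addSubgroupOf ((W.selmerInfty κ ⊓
          ⨅ σ : Field.absoluteGaloisGroup ℚ,
            (localKummerOverOfEmb W p κ.kerSubgroup (closureEmb (K := ℚ) ℚ_[p])
                (⨆ m, strictSignedLocalPoints κ ℚ_[p] W (-1) m)).comap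
              (W.conjH1 p κ.kerSubgroup σ)).comap
          (W.layerToInfty κ 0))) ∧
      (padicValNat p (Nat.card ↥(strictSelmerPInfty W p)) : ℤ) +
          padicValNat p (Nat.card (↥((W.selmerInfty κ ⊓
            ⨅ σ : Field.absoluteGaloisGroup ℚ,
              (localKummerOverOfEmb W p κ.kerSubgroup (closureEmb (K := ℚ) ℚ_[p])
                  (⨆ m, strictSignedLocalPoints κ ℚ_[p] W (-1) m)).comap
                (W.conjH1 p κ.kerSubgroup σ)).comap
            (W.layerToInfty κ 0)) ⧸
          (strictSignedSelmerLayer W κ ℚ_[p] (-1) 0).addSubgroupOf ((W.selmerInfty κ ⊓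
            ⨅ σ : Field.absoluteGaloisGroup ℚ,
              (localKummerOverOfEmb W p κ.kerSubgroup (closureEmb (K := ℚ) ℚ_[p])
                  (⨆ m, strictSignedLocalPoints κ ℚ_[p] W (-1) m)).comap
                (W.conjH1 p κ.kerSubgroup σ)).comap
            (W.layerToInfty κ 0)))) =
        ((PowerSeries.constantCoeff f : ℤ_[p]) : ℚ_[p]).valuation := by
  obtain ⟨hfin, hfinQ, heq⟩ := finite_and_padicValNat_card_localPreimage_add_eq_of_quadraticTwist
    κ W (-1) hp2 hc C hCV M hΔ hA hVM hγ D hX hnf hf h0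
  have hcard :=
    StrictSignedLayerZero.natCard_strictSignedSelmerLayer_neg_one_zero_eq_strictSelmerPInfty W κ
  haveI := hfin
  have hpos : 0 < Nat.card ↥(strictSignedSelmerLayer W κ ℚ_[p] (-1) 0) := Nat.card_pos
  refine ⟨Nat.finite_of_card_ne_zero (by rw [← hcard]; exact hpos.ne'), hfinQ, ?_⟩
  rw [← hcard]
  exact heq

/-- **The same for the `p*`-twist of a globally minimal good `a_p = 0` curve** (consumers'
binders). For `κ` cyclotomic this is, for the TWIST `W = V ⊗ η` of the (C3_η) derivation, the
Selmer side of the typed `QuadraticBranchOddStrictExactControlOfPlusMCAt W p` up to the defect count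
and (C1_η) read on `D`. [cite: Kobayashi2003, Prop. 8.7 (p. 16), Lemma 9.1 (p. 25), Thm. 9.3 (p. 26)]
[cite: GreenbergLNM1716, §3 pp. 85–90 and §4 Lemma 4.2 (p. 102)] -/
theorem finite_and_padicValNat_card_strictSelmerPInfty_localPreimage_add_eq_of_quadraticTwist_signedPrime
    (hp2 : p ≠ 2) (C : VariableChange ℚ) (V : WeierstrassCurve ℚ) [V.IsElliptic]
    [V.IsGloballyMinimal] (hCV : C • W.quadraticTwist ((-1) ^ (p / 2) * p) = V)
    (hgood : V.HasGoodReductionAtPrime p) (hap : V.frobeniusTrace p = 0)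
    (hγ : κ.IsTopGenerator γ) (D : StrictSignedSelmerDualData W κ ℚ_[p] γ (-1))
    [Module.Finite (IwasawaAlgebra p) D.X] (hX : Module.IsTorsion (IwasawaAlgebra p) D.X)
    (hnf : ∀ N : Submodule (IwasawaAlgebra p) D.X, Finite N → N = ⊥)
    {f : IwasawaAlgebra p} (hf : D.charIdeal = Ideal.span {f})
    (h0 : PowerSeries.constantCoeff f ≠ 0) :
    Finite ↥(strictSelmerPInfty W p) ∧
      Finite (↥((W.selmerInfty κ ⊓
          ⨅ σ : Field.absoluteGaloisGroup ℚ,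
            (localKummerOverOfEmb W p κ.kerSubgroup (closureEmb (K := ℚ) ℚ_[p])
                (⨆ m, strictSignedLocalPoints κ ℚ_[p] W (-1) m)).comap
              (W.conjH1 p κ.kerSubgroup σ)).comap
          (W.layerToInfty κ 0)) ⧸
        (strictSignedSelmerLayer W κ ℚ_[p] (-1) 0).addSubgroupOf ((W.selmerInfty κ ⊓
          ⨅ σ : Field.absoluteGaloisGroup ℚ,
            (localKummerOverOfEmb W p κ.kerSubgroup (closureEmb (K := ℚ) ℚ_[p])
                (⨆ m, strictSignedLocalPoints κ ℚ_[p] W (-1) m)).comap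
              (W.conjH1 p κ.kerSubgroup σ)).comap
          (W.layerToInfty κ 0))) ∧
      (padicValNat p (Nat.card ↥(strictSelmerPInfty W p)) : ℤ) +
          padicValNat p (Nat.card (↥((W.selmerInfty κ ⊓
            ⨅ σ : Field.absoluteGaloisGroup ℚ,
              (localKummerOverOfEmb W p κ.kerSubgroup (closureEmb (K := ℚ) ℚ_[p])
                  (⨆ m, strictSignedLocalPoints κ ℚ_[p] W (-1) m)).comap
                (W.conjH1 p κ.kerSubgroup σ)).comap
            (W.layerToInfty κ 0)) ⧸
          (strictSignedSelmerLayer W κ ℚ_[p] (-1) 0).addSubgroupOf ((W.selmerInfty κ ⊓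
            ⨅ σ : Field.absoluteGaloisGroup ℚ,
              (localKummerOverOfEmb W p κ.kerSubgroup (closureEmb (K := ℚ) ℚ_[p])
                  (⨆ m, strictSignedLocalPoints κ ℚ_[p] W (-1) m)).comap
                (W.conjH1 p κ.kerSubgroup σ)).comap
            (W.layerToInfty κ 0)))) =
        ((PowerSeries.constantCoeff f : ℤ_[p]) : ℚ_[p]).valuation := by
  obtain ⟨M, hΔ, hA, hVM⟩ := exists_goodSupersingularPadicModel hp2 V hgood hap
  exact finite_and_padicValNat_card_strictSelmerPInfty_localPreimage_add_eq_of_quadraticTwist W hp2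
    (sq_ne_neg_one_pow_mul_prime hp.out (p / 2)) C hCV M hΔ hA hVM hγ D hX hnf hf h0

end StrictSignedControlZero

end Summit.BirchSwinnertonDyer.Rank1Residual.Additive

end
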